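import Summits.AtomisticToContinuum.FouriersLaw.Theorems.ExtensiveSnapshotIrreversibility.Negative.DegenerateInstances
import Literature.MathematicalPhysics.KineticTheory.LangevinChainGibbs
import HarnessLib

/-!
# Crux `ExtensiveSnapshotIrreversibility` (stmt-AtomisticToContinuum-9121), line `clausius-budget-sound-window`:
stub `stub_correctorCocycle`

Registered stub of the lead's checked skeleton `Cruxes/ExtensiveSnapshotIrreversibility/Lines/clausius-budget-sound-window.lean`
(namespace `…Cruxes.ExtensiveSnapshotIrreversibility.ClausiusBudgetSoundWindow`), proved verbatim (name + signature) so that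
`ledger propose --supports stmt-AtomisticToContinuum-9121` accepts it. See the skeleton's module docstring for the line and the
`let`-dictionary (`μT, g, Pg, k, w, Pw`).

Content: the `L²(μ_T)` bookkeeping step S2b of the line. For the Gibbs state
`μ_T = (pinnedChain ω₂ lam β γ).gibbsMeasure N T`, the momentum flip `Θ(q,p) = (q,-p)` and ARBITRARY
real functions `w, kτ, Pwτ ∈ L²(μ_T)` with `w = kτ + Pwτ` pointwise,
`√∫(w − w∘Θ)² dμ_T ≤ 2 √∫kτ² dμ_T + √∫(Pwτ − Pwτ∘Θ)² dμ_T`.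
Ingredients: Minkowski's inequality in `L²(μ)` in integral form (`sqrt_integral_add_sq_le`, from
Mathlib's `eLpNorm_add_le` and `MemLp.eLpNorm_eq_integral_rpow_norm`) and the flip-invariance of the
Gibbs measure of any oscillator chain (`gibbsMeasure_map_flip`, landed in
`Theorems/ExtensiveSnapshotIrreversibility/Negative/DegenerateInstances.lean`), which makes
`Θ = momentumReversal N` measure preserving for `μ_T`, so `∫ (kτ∘Θ)² dμ_T = ∫ kτ² dμ_T`. No kernel, no
positivity of the parameters and no named fact is used.
-/

noncomputable section

namespace Summit.AtomisticToContinuum.FouriersLaw.Theorems.ExtensiveSnapshotIrreversibility.ClausiusBudget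

open MeasureTheory Filter Topology
open scoped ENNReal NNReal
open Literature.MathematicalPhysics.KineticTheory.HeatConduction

section Minkowski

variable {X : Type*} [MeasurableSpace X] {μ : Measure X}

/-- `‖f‖_{L²(μ)} = ofReal √(∫ f² dμ)` for a real `f ∈ L²(μ)` (Mathlib's
`MemLp.eLpNorm_eq_integral_rpow_norm` at `p = 2`). [folklore] -/
theorem eLpNorm_two_eq_ofReal_sqrt_integral_sq {f : X → ℝ} (hf : MemLp f 2 μ) :
    eLpNorm f 2 μ = ENNReal.ofReal (Real.sqrt (∫ x, f x ^ 2 ∂μ)) := by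
  rw [hf.eLpNorm_eq_integral_rpow_norm two_ne_zero ENNReal.ofNat_ne_top, Real.sqrt_eq_rpow]
  simp only [ENNReal.toReal_ofNat, Real.rpow_two, Real.norm_eq_abs, sq_abs, one_div]

/-- **Minkowski's inequality in `L²(μ)`, integral form.** For real `f, g ∈ L²(μ)` on any measure
space, `√∫(f+g)² dμ ≤ √∫f² dμ + √∫g² dμ` (the triangle inequality `eLpNorm_add_le` for the
`L²` seminorm, transported to Bochner integrals of squares). [folklore] -/
theorem sqrt_integral_add_sq_le {f g : X → ℝ} (hf : MemLp f 2 μ) (hg : MemLp g 2 μ) :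
    Real.sqrt (∫ x, (f x + g x) ^ 2 ∂μ) ≤
      Real.sqrt (∫ x, f x ^ 2 ∂μ) + Real.sqrt (∫ x, g x ^ 2 ∂μ) := by
  have h : eLpNorm (f + g) 2 μ ≤ eLpNorm f 2 μ + eLpNorm g 2 μ :=
    eLpNorm_add_le hf.1 hg.1 one_le_two
  rw [eLpNorm_two_eq_ofReal_sqrt_integral_sq (hf.add hg),
    eLpNorm_two_eq_ofReal_sqrt_integral_sq hf, eLpNorm_two_eq_ofReal_sqrt_integral_sq hg,
    ← ENNReal.ofReal_add (Real.sqrt_nonneg _) (Real.sqrt_nonneg _),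
    ENNReal.ofReal_le_ofReal_iff (add_nonneg (Real.sqrt_nonneg _) (Real.sqrt_nonneg _))] at h
  simpa only [Pi.add_apply] using h

end Minkowski

/-- **Flip-defect cocycle bound for the McLennan corrector (crux `ExtensiveSnapshotIrreversibility`,
line `clausius-budget-sound-window`, step S2b).** For the pinned chain `pinnedChain ω₂ lam β γ`, its
Gibbs state `μ_T = gibbsMeasure N T`, the momentum flip `Θ z = (z.1, -z.2)` and ARBITRARY real
functions `w, kτ, Pwτ ∈ L²(μ_T)` with `w = kτ + Pwτ` pointwise:
`√∫(w − w∘Θ)² dμ_T ≤ 2 √∫kτ² dμ_T + √∫(Pwτ − Pwτ∘Θ)² dμ_T`.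
Proof: pointwise `w − w∘Θ = (kτ + (−kτ∘Θ)) + (Pwτ − Pwτ∘Θ)`; Minkowski in `L²(μ_T)` twice
(`sqrt_integral_add_sq_le`); and `∫ (kτ∘Θ)² dμ_T = ∫ kτ² dμ_T` because `Θ = momentumReversal N`
preserves `μ_T` (`gibbsMeasure_map_flip`, `MeasurePreserving.integral_comp'`), which also gives
`kτ∘Θ, Pwτ∘Θ ∈ L²(μ_T)` (`MemLp.comp_measurePreserving`). The positivity hypotheses on
`ω₂, lam, β, γ, T` and the membership `w ∈ L²(μ_T)` are part of the registered signature but are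
not needed. [folklore] -/
theorem stub_correctorCocycle :
    ∀ ω₂ lam β γ : ℝ, 0 < ω₂ → 0 < lam → 0 < β → 0 < γ → ∀ T : ℝ, 0 < T → ∀ (N : ℕ),
      ∀ w kτ Pwτ : PhaseSpace N → ℝ,
        MemLp w 2 ((pinnedChain ω₂ lam β γ).gibbsMeasure N T) →
        MemLp kτ 2 ((pinnedChain ω₂ lam β γ).gibbsMeasure N T) →
        MemLp Pwτ 2 ((pinnedChain ω₂ lam β γ).gibbsMeasure N T) →
        (∀ z : PhaseSpace N, w z = kτ z + Pwτ z) →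
        Real.sqrt (∫ z, (w z - w (z.1, -z.2)) ^ 2 ∂((pinnedChain ω₂ lam β γ).gibbsMeasure N T)) ≤
          2 * Real.sqrt (∫ z, (kτ z) ^ 2 ∂((pinnedChain ω₂ lam β γ).gibbsMeasure N T)) +
            Real.sqrt (∫ z, (Pwτ z - Pwτ (z.1, -z.2)) ^ 2 ∂((pinnedChain ω₂ lam β γ).gibbsMeasure N T)) := by
  intro ω₂ lam β γ _ _ _ _ T _ N w kτ Pwτ _ hk hPw hsum
  set μ := (pinnedChain ω₂ lam β γ).gibbsMeasure N T with hμ_def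
  -- the momentum flip `Θ = momentumReversal N` preserves the Gibbs state
  have hΘ : MeasurePreserving (momentumReversal N) μ μ :=
    ⟨(momentumReversal N).measurable, Negative.gibbsMeasure_map_flip _ N T⟩
  -- `L²` membership of the flipped functions
  have hkΘ : MemLp (fun z : PhaseSpace N => kτ (z.1, -z.2)) 2 μ := hk.comp_measurePreserving hΘ
  have hkΘn : MemLp (fun z : PhaseSpace N => -kτ (z.1, -z.2)) 2 μ := hkΘ.neg
  have hPwΘ : MemLp (fun z : PhaseSpace N => Pwτ (z.1, -z.2)) 2 μ := hPw.comp_measurePreserving hΘ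
  have hPwd : MemLp (fun z : PhaseSpace N => Pwτ z - Pwτ (z.1, -z.2)) 2 μ := hPw.sub hPwΘ
  -- pointwise decomposition of the flip defect of `w`
  have hdec : (fun z : PhaseSpace N => (w z - w (z.1, -z.2)) ^ 2) =
      fun z => ((kτ z + -kτ (z.1, -z.2)) + (Pwτ z - Pwτ (z.1, -z.2))) ^ 2 := by
    funext z
    rw [hsum z, hsum (z.1, -z.2)]
    ring
  -- Minkowski, twice
  have h1 : Real.sqrt (∫ z, (w z - w (z.1, -z.2)) ^ 2 ∂μ) ≤
      Real.sqrt (∫ z, (kτ z + -kτ (z.1, -z.2)) ^ 2 ∂μ) +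
        Real.sqrt (∫ z, (Pwτ z - Pwτ (z.1, -z.2)) ^ 2 ∂μ) := by
    rw [hdec]
    exact sqrt_integral_add_sq_le (hk.add hkΘn) hPwd
  have h2 : Real.sqrt (∫ z, (kτ z + -kτ (z.1, -z.2)) ^ 2 ∂μ) ≤
      Real.sqrt (∫ z, (kτ z) ^ 2 ∂μ) + Real.sqrt (∫ z, (-kτ (z.1, -z.2)) ^ 2 ∂μ) :=
    sqrt_integral_add_sq_le hk hkΘn
  -- flip-invariance of `μ_T`: `∫ (kτ∘Θ)² dμ_T = ∫ kτ² dμ_T`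
  have h3 : ∫ z, (-kτ (z.1, -z.2)) ^ 2 ∂μ = ∫ z, (kτ z) ^ 2 ∂μ := by
    simp only [neg_sq]
    exact hΘ.integral_comp' (f := momentumReversal N) fun z => (kτ z) ^ 2
  rw [h3] at h2
  linarith

end Summit.AtomisticToContinuum.FouriersLaw.Theorems.ExtensiveSnapshotIrreversibility.ClausiusBudget

end
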